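import Mathlib
import Literature.Computability.AlgebraicComplexity.SymbolicMatrixDecomposition

/-!
# Crux `DetQP.DetqpSuperquadratic` (stmt-ValiantsHypothesis-0318), line
# `linear-homogenisation-transfer` — stub `stub_krylovIdentities` (S1b): the Krylov identities

Let `K` be any commutative ring, `f ∈ K[x_σ]` homogeneous of degree `n ≥ 2`, and let
`ρ, γ ∈ (K[x]_1)^w`, `L ∈ M_w(K[x]_1)` be homogeneous LINEAR data with `ρᵀ adj(1 + L) γ = f`
(a bordered adjugate form = a determinantal expression of size `w + 1` in vertex gauge).  Then, with
`D = −L` and `h_j := ρᵀ Dʲ γ` (a form of degree `j + 2`):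

* (A3) `h_{n−2} = f`;
* (A2) `h_j = 0` for `j < n − 2`;
* (A4) `f ∣ h_j` for every `j`.

(A2)/(A3) are the second half of the proof of Chatterjee–Kumar–Volk, *Determinants vs. Algebraic
Branching Programs*, comput. complexity 33 (2024), arXiv:2308.04599, Theorem 13 (there over a field,
via the power series `(1 − D)⁻¹ = Σ Dⁱ` in `F[[x]]`) and the remark following it; (A4) is one more
line from the same identity and is not in print.  Here everything happens inside the
polynomial ring: from `(Σ_{i<N} Dⁱ)(1 − D) = 1 − D^N` (`geom_sum_mul_neg`) and
`(1 − D) adj(1 − D) = det(1 − D)` (`Matrix.mul_adjugate`) we get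
`adj(1 − D) = det(1 − D) Σ_{i<N} Dⁱ + D^N adj(1 − D)` (`adjugate_contraction_eq`); contracting
with `ρ, γ` for `N = j + 1` gives
`f = q · Σ_{i ≤ j} h_i + E` with `q = det(1 + L)` (constant coefficient `1`) and `E` without
components of degree `≤ j + 2`.  Multiplying by the truncated inverse
`q′ = Σ_{k < j+3} (1 − q)ᵏ` (`q′ q = 1 − (1 − q)^{j+3}`) and taking homogeneous components of degree
`j + 2` yields the **main identity** `h_j = [q′ f]_{j+2}` (`krylov_main`), which is `0` for
`j + 2 < n` and `[q′]_{j+2−n} · f` for `j + 2 ≥ n`; the three items are read off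
(`[q′]_0 = 1`).  The graded bookkeeping uses `MvPolynomial.homogeneousComponent` and the grading
`MvPolynomial.gradedAlgebra`; the vanishing of low components of `(1 − q)ᵏ` is the tree lemma
`Literature.Computability.AlgebraicComplexity.coeff_pow_eq_zero_of_degree_lt`.

The skeleton of the line instantiates `K = ℂ`, `σ = Fin n × Fin n`, `f = per_n`.
-/

-- `Summit.ValiantsHypothesis.ValiantsHypothesis.…` is the tree's mandated single-conjunct layout
-- (Sub = Summit), so the duplicated namespace component is intended.
set_option linter.dupNamespace false

open MvPolynomial Matrix

namespace Summit.ValiantsHypothesis.ValiantsHypothesis.Theorems.DetQPDetqpSuperquadratic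

namespace Krylov

/-! ## Homogeneous components of products -/

section Graded

variable {σ : Type*} {R : Type*} [CommRing R]

/-- Component of `a * b` in degree `d` when `a` is homogeneous of degree `i`: it is
`a · [b]_{d-i}` if `i ≤ d` and `0` otherwise (the grading `MvPolynomial.gradedAlgebra`, used as a
term-local instance). [folklore] -/
theorem homogeneousComponent_mul_left {a : MvPolynomial σ R} {i : ℕ} (ha : a.IsHomogeneous i)
    (b : MvPolynomial σ R) (d : ℕ) :
    homogeneousComponent d (a * b) = if i ≤ d then a * homogeneousComponent (d - i) b else 0 := by
  letI := MvPolynomial.gradedAlgebra (σ := σ) (R := R)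
  have h := DirectSum.coe_decompose_mul_of_left_mem (𝒜 := homogeneousSubmodule σ R) (b := b) d
    ((mem_homogeneousSubmodule i a).2 ha)
  have e1 : ((DirectSum.decompose (homogeneousSubmodule σ R) (a * b)) d : MvPolynomial σ R) =
      homogeneousComponent d (a * b) :=
    decomposition.decompose'_apply (a * b) d
  have e2 : ((DirectSum.decompose (homogeneousSubmodule σ R) b) (d - i) : MvPolynomial σ R) =
      homogeneousComponent (d - i) b :=
    decomposition.decompose'_apply b (d - i)
  rw [e1, e2] at h
  exact h

/-- Component of `a * b` in degree `d` when `b` is homogeneous of degree `i`: it is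
`[a]_{d-i} · b` if `i ≤ d` and `0` otherwise. [folklore] -/
theorem homogeneousComponent_mul_right (a : MvPolynomial σ R) {b : MvPolynomial σ R} {i : ℕ}
    (hb : b.IsHomogeneous i) (d : ℕ) :
    homogeneousComponent d (a * b) = if i ≤ d then homogeneousComponent (d - i) a * b else 0 := by
  letI := MvPolynomial.gradedAlgebra (σ := σ) (R := R)
  have h := DirectSum.coe_decompose_mul_of_right_mem (𝒜 := homogeneousSubmodule σ R) (a := a) d
    ((mem_homogeneousSubmodule i b).2 hb)
  have e1 : ((DirectSum.decompose (homogeneousSubmodule σ R) (a * b)) d : MvPolynomial σ R) =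
      homogeneousComponent d (a * b) :=
    decomposition.decompose'_apply (a * b) d
  have e2 : ((DirectSum.decompose (homogeneousSubmodule σ R) a) (d - i) : MvPolynomial σ R) =
      homogeneousComponent (d - i) a :=
    decomposition.decompose'_apply a (d - i)
  rw [e1, e2] at h
  exact h

/-- Component of `a * b` in degree `d` with `a` homogeneous of degree `i > d` vanishes.
[folklore] -/
theorem homogeneousComponent_mul_left_of_lt {a b : MvPolynomial σ R} {i d : ℕ}
    (ha : a.IsHomogeneous i) (h : d < i) : homogeneousComponent d (a * b) = 0 := by
  rw [homogeneousComponent_mul_left ha, if_neg (not_le.2 h)]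

/-- If `x` has no homogeneous components of degree `≤ d` then neither has `x * y` in degree `d`.
[folklore] -/
theorem homogeneousComponent_mul_eq_zero_of_low {x y : MvPolynomial σ R} {d : ℕ}
    (hx : ∀ d' ≤ d, homogeneousComponent d' x = 0) : homogeneousComponent d (x * y) = 0 := by
  classical
  conv_lhs => rw [← sum_homogeneousComponent x]
  rw [Finset.sum_mul, map_sum]
  refine Finset.sum_eq_zero fun i _ => ?_
  by_cases hi : i ≤ d
  · rw [hx i hi, zero_mul, map_zero]
  · exact homogeneousComponent_mul_left_of_lt (homogeneousComponent_isHomogeneous i x) (not_le.1 hi)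

/-- A homogeneous polynomial of degree `i` has component `φ` in degree `i` and `0` elsewhere.
[folklore] -/
theorem homogeneousComponent_of_isHomogeneous {φ : MvPolynomial σ R} {i d : ℕ}
    (h : φ.IsHomogeneous i) : homogeneousComponent d φ = if d = i then φ else 0 :=
  homogeneousComponent_of_mem ((mem_homogeneousSubmodule i φ).2 h)

/-- `ε ^ k` with `constantCoeff ε = 0` has no component of degree `< k`. [folklore] -/
theorem homogeneousComponent_pow_eq_zero_of_lt {ε : MvPolynomial σ R} (hε : constantCoeff ε = 0)
    {k d : ℕ} (hd : d < k) : homogeneousComponent d (ε ^ k) = 0 := by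
  classical
  rw [homogeneousComponent_eq_zero']
  intro m hm hdeg
  have := Literature.Computability.AlgebraicComplexity.coeff_pow_eq_zero_of_degree_lt hε k m
    (by rw [hdeg]; exact hd)
  exact (mem_support_iff.1 hm) this

end Graded

/-! ## Matrices of linear forms -/

/-- Entries of powers of a matrix of linear forms are forms of the corresponding degree.
[folklore] -/
theorem isHomogeneous_pow_apply {σ : Type*} {K : Type*} [CommRing K] {ι : Type*} [Fintype ι]
    [DecidableEq ι] (A : Matrix ι ι (MvPolynomial σ K)) (hA : ∀ p q, (A p q).IsHomogeneous 1)
    (k : ℕ) (p q : ι) : ((A ^ k) p q).IsHomogeneous k := by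
  induction k generalizing p q with
  | zero =>
    rw [pow_zero, Matrix.one_apply]
    split_ifs
    · exact isHomogeneous_one σ K
    · exact isHomogeneous_zero σ K 0
  | succ k ih =>
    rw [pow_succ, Matrix.mul_apply]
    exact IsHomogeneous.sum _ _ _ fun r _ => (ih p r).mul (hA r q)

/-- `ρᵀ A γ` is a form of degree `k + 2` if `A` has entries of degree `k` and `ρ, γ` are linear.
[folklore] -/
theorem isHomogeneous_dotProduct_mulVec {σ : Type*} {K : Type*} [CommRing K] {ι : Type*}
    [Fintype ι] {ρ γ : ι → MvPolynomial σ K} {A : Matrix ι ι (MvPolynomial σ K)} {k : ℕ}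
    (hρ : ∀ i, (ρ i).IsHomogeneous 1) (hγ : ∀ i, (γ i).IsHomogeneous 1)
    (hA : ∀ p q, (A p q).IsHomogeneous k) : (ρ ⬝ᵥ (A *ᵥ γ)).IsHomogeneous (k + 2) := by
  unfold dotProduct Matrix.mulVec
  refine IsHomogeneous.sum _ _ _ fun i _ => ?_
  have h2 : (∑ j, A i j * γ j).IsHomogeneous (k + 1) :=
    IsHomogeneous.sum _ _ _ fun j _ => (hA i j).mul (hγ j)
  have := (hρ i).mul h2
  rwa [show 1 + (k + 1) = k + 2 by ring] at this

/-- `ρᵀ (∑_{i<N} Dⁱ) γ = ∑_{i<N} ρᵀ Dⁱ γ`. [folklore] -/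
theorem dotProduct_geom_sum_mulVec {S : Type*} [CommRing S] {ι : Type*} [Fintype ι]
    [DecidableEq ι] (ρ γ : ι → S) (D : Matrix ι ι S) (N : ℕ) :
    ρ ⬝ᵥ ((∑ i ∈ Finset.range N, D ^ i) *ᵥ γ) = ∑ i ∈ Finset.range N, ρ ⬝ᵥ (D ^ i *ᵥ γ) := by
  induction N with
  | zero => simp
  | succ N ih =>
    rw [Finset.sum_range_succ, Matrix.add_mulVec, dotProduct_add, ih, Finset.sum_range_succ]

/-- The key decomposition (any commutative ring): with `G = Σ_{i<N} Dⁱ`,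
`adj(1 − D) = det(1 − D) · G + D^N · adj(1 − D)`, contracted with `ρ, γ`. [folklore] -/
theorem adjugate_contraction_eq {S : Type*} [CommRing S] {ι : Type*} [Fintype ι] [DecidableEq ι]
    (ρ γ : ι → S) (D : Matrix ι ι S) (N : ℕ) :
    ρ ⬝ᵥ ((1 - D).adjugate *ᵥ γ) =
      (1 - D).det * (ρ ⬝ᵥ ((∑ i ∈ Finset.range N, D ^ i) *ᵥ γ)) +
        ρ ⬝ᵥ ((D ^ N * (1 - D).adjugate) *ᵥ γ) := by
  have h1 : (∑ i ∈ Finset.range N, D ^ i) * (1 - D) = 1 - D ^ N := geom_sum_mul_neg D N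
  have h2 : (1 - D) * (1 - D).adjugate = (1 - D).det • (1 : Matrix ι ι S) :=
    Matrix.mul_adjugate (1 - D)
  have hBeq : (1 - D).adjugate =
      (1 - D).det • (∑ i ∈ Finset.range N, D ^ i) + D ^ N * (1 - D).adjugate := by
    calc (1 - D).adjugate
          = ((∑ i ∈ Finset.range N, D ^ i) * (1 - D) + D ^ N) * (1 - D).adjugate := by
          rw [h1, sub_add_cancel, Matrix.one_mul]
      _ = (∑ i ∈ Finset.range N, D ^ i) * ((1 - D) * (1 - D).adjugate) +
            D ^ N * (1 - D).adjugate := by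
          rw [Matrix.add_mul, Matrix.mul_assoc]
      _ = (1 - D).det • (∑ i ∈ Finset.range N, D ^ i) + D ^ N * (1 - D).adjugate := by
          rw [h2, Matrix.mul_smul, Matrix.mul_one]
  conv_lhs => rw [hBeq]
  rw [Matrix.add_mulVec, Matrix.smul_mulVec, dotProduct_add, dotProduct_smul, smul_eq_mul]

/-! ## The truncated inverse of `det (1 + L)` and the main identity -/

/-- `det (1 + L)` has constant coefficient `1` when `L` has linear entries. [folklore] -/
theorem constantCoeff_det_one_add {σ : Type*} {K : Type*} [CommRing K] {w : ℕ}
    {L : Matrix (Fin w) (Fin w) (MvPolynomial σ K)} (hL : ∀ i j, (L i j).IsHomogeneous 1) :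
    constantCoeff ((1 + L).det) = 1 := by
  rw [RingHom.map_det]
  have : (RingHom.mapMatrix constantCoeff) (1 + L) = (1 : Matrix (Fin w) (Fin w) K) := by
    ext i j
    rw [RingHom.mapMatrix_apply, Matrix.map_apply, Matrix.add_apply, map_add, Matrix.one_apply,
      Matrix.one_apply]
    have h0 : constantCoeff (L i j) = 0 := by
      rw [constantCoeff_eq]
      exact (hL i j).coeff_eq_zero (by simp)
    rw [h0, add_zero]
    split_ifs <;> simp
  rw [this, Matrix.det_one]

/-- The truncated inverse `q′ = Σ_{k < j+3} (1 − det(1 + L))ᵏ` of `det (1 + L)`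
(`q′ · det(1 + L) = 1 − (1 − det(1 + L))^{j+3}`) has constant coefficient `1`. [folklore] -/
theorem constantCoeff_truncInv {σ : Type*} {K : Type*} [CommRing K] {w : ℕ}
    {L : Matrix (Fin w) (Fin w) (MvPolynomial σ K)} (hL : ∀ i j, (L i j).IsHomogeneous 1)
    (j : ℕ) : constantCoeff (∑ k ∈ Finset.range (j + 3), (1 - (1 + L).det) ^ k) = 1 := by
  rw [map_sum]
  simp only [map_pow, map_sub, map_one, constantCoeff_det_one_add hL, sub_self]
  rw [Finset.sum_eq_single 0 (fun k _ hk => zero_pow hk) (by simp)]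
  simp

/-- **Main identity** (Chatterjee–Kumar–Volk 2024, proof of Thm. 13, made polynomial):
for homogeneous linear `ρ, γ, L` with `ρᵀ adj(1 + L) γ = f`, `f` homogeneous of degree `n`,
`ρᵀ (−L)ʲ γ = [q′ · f]_{j+2}`, i.e. `0` if `j + 2 < n` and `[q′]_{j+2−n} · f` otherwise, where
`q′ = Σ_{k < j+3} (1 − det(1 + L))ᵏ` is the truncated inverse of `det (1 + L)`.
[cite: ChatterjeeKumarVolk2024, Theorem 13] -/
theorem krylov_main {σ : Type*} {K : Type*} [CommRing K] {n w : ℕ} {f : MvPolynomial σ K}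
    (ρ γ : Fin w → MvPolynomial σ K) (L : Matrix (Fin w) (Fin w) (MvPolynomial σ K))
    (hf : f.IsHomogeneous n) (hρ : ∀ i, (ρ i).IsHomogeneous 1) (hγ : ∀ i, (γ i).IsHomogeneous 1)
    (hL : ∀ i j, (L i j).IsHomogeneous 1) (hadj : ρ ⬝ᵥ ((1 + L).adjugate *ᵥ γ) = f) (j : ℕ) :
    ρ ⬝ᵥ ((-L) ^ j *ᵥ γ) =
      if n ≤ j + 2 then
        homogeneousComponent (j + 2 - n) (∑ k ∈ Finset.range (j + 3), (1 - (1 + L).det) ^ k) * f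
      else 0 := by
  classical
  -- notation: `D = -L` has linear entries, `h_i := ρᵀ Dⁱ γ` is a form of degree `i + 2`,
  -- `q' = Σ_{k<j+3} (1 - det (1 + L))ᵏ` is the truncated inverse of `det (1 + L)`
  set q' : MvPolynomial σ K := ∑ k ∈ Finset.range (j + 3), (1 - (1 + L).det) ^ k
  set D : Matrix (Fin w) (Fin w) (MvPolynomial σ K) := -L with hDdef
  have hD1 : (1 : Matrix (Fin w) (Fin w) (MvPolynomial σ K)) - D = 1 + L := by
    rw [hDdef, sub_neg_eq_add]
  have hD : ∀ p q, (D p q).IsHomogeneous 1 := fun p q => by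
    rw [hDdef, Matrix.neg_apply]; exact (hL p q).neg
  have hhom : ∀ i, (ρ ⬝ᵥ (D ^ i *ᵥ γ)).IsHomogeneous (i + 2) := fun i =>
    isHomogeneous_dotProduct_mulVec hρ hγ (isHomogeneous_pow_apply D hD i)
  -- the decomposition with `N = j + 1`
  set E := ρ ⬝ᵥ ((D ^ (j + 1) * (1 + L).adjugate) *ᵥ γ) with hE
  set H := ∑ i ∈ Finset.range (j + 1), ρ ⬝ᵥ (D ^ i *ᵥ γ) with hH
  have key : f = (1 + L).det * H + E := by
    have := adjugate_contraction_eq ρ γ D (j + 1)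
    rw [hD1, hadj, dotProduct_geom_sum_mulVec] at this
    exact this
  -- truncated inverse
  have hε : constantCoeff (1 - (1 + L).det) = 0 := by
    rw [map_sub, map_one, constantCoeff_det_one_add hL, sub_self]
  have hq'q : q' * (1 + L).det = 1 - (1 - (1 + L).det) ^ (j + 3) := by
    have := geom_sum_mul_neg (1 - (1 + L).det) (j + 3)
    rwa [sub_sub_cancel] at this
  have eq1 : H = q' * f + ((1 - (1 + L).det) ^ (j + 3) * H - q' * E) := by
    have h3 : q' * f = (1 - (1 - (1 + L).det) ^ (j + 3)) * H + q' * E := by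
      rw [key, mul_add, ← mul_assoc, hq'q]
    linear_combination -h3
  -- take the homogeneous component of degree `j + 2`
  have cH : homogeneousComponent (j + 2) H = ρ ⬝ᵥ (D ^ j *ᵥ γ) := by
    rw [hH, map_sum, Finset.sum_eq_single_of_mem j (by simp)]
    · rw [homogeneousComponent_of_isHomogeneous (hhom j), if_pos rfl]
    · intro i _ hij
      rw [homogeneousComponent_of_isHomogeneous (hhom i), if_neg (by omega)]
  have cT2 : homogeneousComponent (j + 2) ((1 - (1 + L).det) ^ (j + 3) * H) = 0 :=
    homogeneousComponent_mul_eq_zero_of_low fun d' hd' =>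
      homogeneousComponent_pow_eq_zero_of_lt hε (by omega)
  have cE : ∀ d' ≤ j + 2, homogeneousComponent d' E = 0 := by
    intro d' hd'
    rw [hE]
    simp only [dotProduct, Matrix.mulVec, Matrix.mul_apply, Finset.sum_mul, Finset.mul_sum, map_sum]
    refine Finset.sum_eq_zero fun a _ => Finset.sum_eq_zero fun b _ =>
      Finset.sum_eq_zero fun c _ => ?_
    have hre : ρ a * ((D ^ (j + 1)) a c * (1 + L).adjugate c b * γ b) =
        (ρ a * (D ^ (j + 1)) a c * γ b) * (1 + L).adjugate c b := by ring
    rw [hre]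
    exact homogeneousComponent_mul_left_of_lt
      (((hρ a).mul (isHomogeneous_pow_apply D hD (j + 1) a c)).mul (hγ b)) (by omega)
  have cT3 : homogeneousComponent (j + 2) (q' * E) = 0 := by
    rw [mul_comm]
    exact homogeneousComponent_mul_eq_zero_of_low cE
  have := congrArg (homogeneousComponent (j + 2)) eq1
  rw [cH, map_add, map_sub, homogeneousComponent_mul_right q' hf, cT2, cT3, sub_zero,
    add_zero] at this
  exact this

end Krylov

/-- Registered stub **S1b** `stub_krylovIdentities` of line `linear-homogenisation-transfer`
(Chatterjee–Kumar–Volk 2024, Thm. 13, second half of the proof, plus the divisibility (A4)):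
for ANY commutative ring `K`, any homogeneous `f` of degree `n ≥ 2` and homogeneous linear
`ρ, γ, L` with `ρᵀ adj(1 + L) γ = f`, the data `(ρ, γ, −L)` is a Krylov normal form of `f`:
(A3) `ρᵀ(−L)^(n−2)γ = f`, (A2) `ρᵀ(−L)ʲγ = 0` for `j < n − 2`, (A4) `f ∣ ρᵀ(−L)ʲγ` for all `j` —
read off `Krylov.krylov_main`. [cite: ChatterjeeKumarVolk2024, Theorem 13] -/
theorem stub_krylovIdentities :
    ∀ (K : Type) [CommRing K] (σ : Type) (n w : ℕ) (f : MvPolynomial σ K)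
      (ρ γ : Fin w → MvPolynomial σ K) (L : Matrix (Fin w) (Fin w) (MvPolynomial σ K)),
      2 ≤ n → f.IsHomogeneous n → (∀ i, (ρ i).IsHomogeneous 1) → (∀ i, (γ i).IsHomogeneous 1) →
      (∀ i j, (L i j).IsHomogeneous 1) → ρ ⬝ᵥ ((1 + L).adjugate *ᵥ γ) = f →
      ρ ⬝ᵥ (((-L) ^ (n - 2)) *ᵥ γ) = f ∧
      (∀ j : ℕ, j < n - 2 → ρ ⬝ᵥ (((-L) ^ j) *ᵥ γ) = 0) ∧
      (∀ j : ℕ, f ∣ ρ ⬝ᵥ (((-L) ^ j) *ᵥ γ)) := by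
  intro K _ σ n w f ρ γ L hn hf hρ hγ hL hadj
  have main := Krylov.krylov_main ρ γ L hf hρ hγ hL hadj
  refine ⟨?_, fun j hj => ?_, fun j => ?_⟩
  · rw [main (n - 2), if_pos (by omega), show n - 2 + 2 - n = 0 by omega,
      homogeneousComponent_zero, ← constantCoeff_eq, Krylov.constantCoeff_truncInv hL, C_1, one_mul]
  · rw [main j, if_neg (by omega)]
  · rw [main j]
    split_ifs
    · exact Dvd.intro_left _ rfl
    · exact dvd_zero _

end Summit.ValiantsHypothesis.ValiantsHypothesis.Theorems.DetQPDetqpSuperquadratic
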